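import Mathlib
import HarnessLib
import Summits.Ventures.LatticeQCDFlow.Scaling.U1IdentityFlowHoldingTime
import Summits.Ventures.LatticeQCDFlow.Scaling.EssBhattacharyyaCeilingIntegral

/-!
# LatticeQCDFlow / Scaling — the untrained 2-d U(1) sampler: the equilibrium HOLDING TIME grows at
# exactly the ESS rate `I₀(2β)/I₀(β)²` per plaquette, while the mean acceptance decays at the
# Bhattacharyya rate — and `I₀(β)²/I₀(2β) ≤ I₀(β/2)²/I₀(β)`

HONEST FRAMING: exact (Metropolis-corrected) sampling algorithms for lattice gauge theory;
figures of merit are autocorrelation/cost numbers at stated couplings and volumes; no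
continuum-physics claim.

Venture `LatticeQCDFlow` (cell pub-lqcd), topic `Scaling`; FANOUT row 3 (`s0-u1-a`, S0-B
implementation A: the 2-d U(1) flow sampler, GEN-15).  NEW WORK of the cell (closed forms, no
numerics); NO definition is introduced.  Row 3's `Scaling/U1IdentityFlowHoldingTime` (GEN-12,
imported) pinned the equilibrium mean holding time `E_π[1/a(x)] = ∫ P/(1 − λ(P/Q))` of the exact
untrained chain on `V` independent plaquettes within `[(I₀(2β)/I₀(β)²)^V, 2(I₀(2β)/I₀(β)²)^V]`;
row 3's `Scaling/AcceptanceVolumeRatePi` / `Scaling/U1IdentityFlowVolumeRate` (GEN-15) show that the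
MEAN ACCEPTANCE `E[a] = acc_V` decays at the exact rate `I₀(β/2)²/I₀(β)` (Bhattacharyya) per
plaquette.  This file types the two remaining facts:

* **`tendsto_u1IdentityFlow_holdingTime_rpow_inv`** — `(E_π[1/a])^{1/V} → I₀(2β)/I₀(β)²` as
  `V → ∞`: the holding time grows at EXACTLY the inverse effective-sample-size rate;
* **`tendsto_holdingTime_pi_const_rpow_inv`** — the same for EVERY factorised flow with positive
  normalised block densities and `W₂ = ∫(p/q)p < ∞`: `(E_π[1/a])^{1/m} → W₂ = 1/ESS₁`
  (`integral_piWeightMoment_const`: `∫(P/Q)P d(⊗ν) = W₂^m`);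
* **`besselI_sq_div_le_bhatt_sq`** — `I₀(β)²/I₀(2β) ≤ I₀(β/2)²/I₀(β)` for every real `β`, i.e.
  `ESS₁ ≤ BC₁²` for one plaquette — a Bessel-function inequality (`I₀(β)³ ≤ I₀(β/2)²·I₀(2β)`,
  log-convexity of the weight moments) obtained from row 3's general-space `ESS ≤ BC²`
  (`Scaling/EssBhattacharyyaCeilingIntegral`, GEN-15, imported).

Reading (value-free; no number of ours is computed or implied): for the zero-training exact sampler
of the factorised 2-d U(1) model the two natural acceptance figures of merit have DIFFERENT
exponential rates in the volume — the harmonic-mean acceptance `1/E_π[1/a]` (equivalently the mean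
holding time) runs at the ESS rate `log(I₀(2β)/I₀(β)²)` per plaquette, the arithmetic-mean
acceptance `E[a]` at the Bhattacharyya rate `log(I₀(β)/I₀(β/2)²) ≤` the former; a LEADERBOARD
acceptance column and an ESS column of the same sampler are therefore not interchangeable even on
the logarithmic scale.  NOT CLAIMED: strictness of the rate gap (it is the hit-or-miss equality
case, excluded for `β ≠ 0`, but not typed here); any value at the cell's `(β, L)`; nothing
re-scored, SEALED.md untouched.
-/

namespace Summit.Ventures.LatticeQCDFlow.Theory2

open MeasureTheory Real Set Finset Filter Topology
open Summit.Ventures.LatticeQCDFlow.Exactness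
open Literature.Analysis.FunctionSpaces (besselI besselI_zero_pos)
open Summit.Ventures.LatticeQCDFlow.Scoring (onePlaquetteZ onePlaquetteZ_pos onePlaquetteZ_eq_besselI)

/-- A sequence squeezed in `[X^V, 2·X^V]` (`X > 0`) has `V`-th roots tending to `X`. [folklore] -/
theorem tendsto_rpow_inv_of_mem_Icc_pow {X : ℝ} (hX : 0 < X) {h : ℕ → ℝ}
    (hh : ∀ V : ℕ, h V ∈ Set.Icc (X ^ V) (2 * X ^ V)) :
    Tendsto (fun V : ℕ => h V ^ (1 / (V : ℝ))) atTop (𝓝 X) := by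
  -- upper envelope `2^{1/V}·X → X`
  have h2 : Tendsto (fun V : ℕ => (2 : ℝ) ^ (1 / (V : ℝ)) * X) atTop (𝓝 X) := by
    have hlog : Tendsto (fun V : ℕ => Real.log 2 * (1 / (V : ℝ))) atTop (𝓝 0) := by
      simpa using (tendsto_inv_atTop_nhds_zero_nat (𝕜 := ℝ)).const_mul (Real.log 2)
    have hexp := (Real.continuous_exp.tendsto 0).comp hlog
    rw [Real.exp_zero] at hexp
    have : Tendsto (fun V : ℕ => (2 : ℝ) ^ (1 / (V : ℝ))) atTop (𝓝 1) :=
      hexp.congr fun V => by simp only [Function.comp_apply]; rw [Real.rpow_def_of_pos two_pos]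
    simpa using this.mul_const X
  refine tendsto_of_tendsto_of_tendsto_of_le_of_le' tendsto_const_nhds h2 ?_ ?_
  · filter_upwards [eventually_gt_atTop 0] with V hV
    have hV' : (V : ℝ) ≠ 0 := Nat.cast_ne_zero.2 hV.ne'
    calc X = (X ^ V) ^ (1 / (V : ℝ)) := by rw [one_div, Real.pow_rpow_inv_natCast hX.le hV.ne']
      _ ≤ h V ^ (1 / (V : ℝ)) :=
        Real.rpow_le_rpow (pow_nonneg hX.le _) (hh V).1 (by positivity)
  · filter_upwards [eventually_gt_atTop 0] with V hV
    calc h V ^ (1 / (V : ℝ)) ≤ (2 * X ^ V) ^ (1 / (V : ℝ)) :=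
          Real.rpow_le_rpow (le_trans (pow_nonneg hX.le _) (hh V).1) (hh V).2 (by positivity)
      _ = (2 : ℝ) ^ (1 / (V : ℝ)) * X := by
          rw [Real.mul_rpow zero_le_two (pow_nonneg hX.le _), one_div,
            Real.pow_rpow_inv_natCast hX.le hV.ne']

/-- **THE HOLDING TIME GROWS AT EXACTLY THE INVERSE-ESS RATE**: for the untrained exact sampler of
`V` independent U(1) plaquettes, `(∫ P/(1 − λ(P/Q)) d(⊗μ))^{1/V} → I₀(2β)/I₀(β)²` as `V → ∞`
(`λ = rejCurve`; the integral is the equilibrium mean holding time `E_π[1/a]`). [ours] -/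
theorem tendsto_u1IdentityFlow_holdingTime_rpow_inv (β : ℝ) :
    Tendsto (fun V : ℕ => (∫ x, (∏ i : Fin V, Real.exp (β * Real.cos (x i)) / onePlaquetteZ β)
        / (1 - rejCurve (Measure.pi fun _ : Fin V => volume.restrict (Ioc (0 : ℝ) (2 * π)))
            (fun x : Fin V → ℝ => ∏ i, Real.exp (β * Real.cos (x i)) / onePlaquetteZ β)
            (fun _ : Fin V → ℝ => ∏ _i : Fin V, (1 / (2 * π) : ℝ))
            ((∏ i, Real.exp (β * Real.cos (x i)) / onePlaquetteZ β) / ∏ _i : Fin V, (1 / (2 * π) : ℝ)))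
        ∂(Measure.pi fun _ : Fin V => volume.restrict (Ioc (0 : ℝ) (2 * π)))) ^ (1 / (V : ℝ)))
      atTop (𝓝 (besselI 0 (2 * β) / besselI 0 β ^ 2)) := by
  refine tendsto_rpow_inv_of_mem_Icc_pow (div_pos (besselI_zero_pos _) (pow_pos (besselI_zero_pos _) 2))
    fun V => ?_
  have h := u1IdentityFlow_holdingTime_mem_Icc (ι := Fin V) β
  rwa [Fintype.card_fin] at h

/-- **`I₀(β)²/I₀(2β) ≤ I₀(β/2)²/I₀(β)`** — one-plaquette `ESS₁ ≤ BC₁²`, from row 3's general-space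
`ESS ≤ BC²` with the closed forms `∫ p_β²/q = I₀(2β)/I₀(β)²`, `(∫√(p_β q))² = I₀(β/2)²/I₀(β)`.
[ours] -/
theorem besselI_sq_div_le_bhatt_sq (β : ℝ) :
    besselI 0 β ^ 2 / besselI 0 (2 * β) ≤ besselI 0 (β / 2) ^ 2 / besselI 0 β := by
  have h := essFrac_le_sq_integral_sqrt (μ := volume.restrict (Ioc (0 : ℝ) (2 * π)))
    (fun θ => (u1Wilson_pos β θ).le) (measurable_u1Wilson β) (integrable_u1Wilson β)
    (integral_u1Wilson β) (fun _ => by positivity) measurable_const integrable_u1Haar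
    (integrable_u1Wilson_sq_div β)
  rw [integral_u1Wilson, integral_u1Wilson_sq_div, integral_sqrt_u1Wilson_mul, one_pow, div_pow,
    Real.sq_sqrt (besselI_zero_pos β).le, one_div, inv_div] at h
  exact h

/-- **`I₀(β)³ ≤ I₀(β/2)²·I₀(2β)`** — the same inequality cleared of denominators (log-convexity of
`γ ↦ I₀(γ)` along `β/2, β, 2β` in the weights `2/3, 1/3`). [ours] -/
theorem besselI_pow_three_le (β : ℝ) :
    besselI 0 β ^ 3 ≤ besselI 0 (β / 2) ^ 2 * besselI 0 (2 * β) := by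
  have h := besselI_sq_div_le_bhatt_sq β
  have h1 := besselI_zero_pos β
  have h2 := besselI_zero_pos (2 * β)
  rw [div_le_div_iff₀ h2 h1] at h
  nlinarith [h]

/-! ## The holding-time rate of a general factorised flow -/

section General

variable {ι : Type*} [Fintype ι] {Y : Type*} [MeasurableSpace Y] {ν : Measure Y} [SigmaFinite ν]

/-- **`∫ (P/Q)·P d(⊗ν) = (∫ (p/q)·p dν)^m`** — the second weight moment of `m` identical independent
blocks. [ours] -/
theorem integral_piWeightMoment_const (p q : Y → ℝ) :
    ∫ x, (∏ i : ι, p (x i)) / (∏ i : ι, q (x i)) * ∏ i : ι, p (x i) ∂(Measure.pi fun _ : ι => ν)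
      = (∫ a, p a / q a * p a ∂ν) ^ Fintype.card ι := by
  have e : ∀ x : ι → Y, (∏ i : ι, p (x i)) / (∏ i : ι, q (x i)) * ∏ i : ι, p (x i)
      = ∏ i, (p (x i) / q (x i) * p (x i)) := by
    intro x; rw [prod_mul_distrib, prod_div_distrib]
  simp_rw [e]
  exact integral_fintype_prod_eq_pow (ι := ι) (fun a => p a / q a * p a)

/-- **THE HOLDING TIME OF A FACTORISED FLOW GROWS AT EXACTLY THE INVERSE-ESS RATE.**  For a
positive normalised block target `p`, a positive normalised block model `q` with second weight
moment `W₂ = ∫ (p/q)·p dν < ∞`, the equilibrium mean holding time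
`E_π[1/a] = ∫ P/(1 − λ(P/Q)) d(⊗ν)` of the exact sampler on `m` independent identical blocks
satisfies `(E_π[1/a])^{1/m} → W₂ = 1/ESS₁` (row 2's sandwich `[W₂^m, 2W₂^m]` on the product space).
[ours] -/
theorem tendsto_holdingTime_pi_const_rpow_inv {p q : Y → ℝ} (hp0 : ∀ a, 0 < p a)
    (hpm : Measurable p) (hpi : Integrable p ν) (hp1 : ∫ a, p a ∂ν = 1) (hq0 : ∀ a, 0 < q a)
    (hqm : Measurable q) (hqi : Integrable q ν) (hq1 : ∫ a, q a ∂ν = 1)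
    (hW : Integrable (fun a => p a / q a * p a) ν) :
    Tendsto (fun m : ℕ => (∫ x, (∏ i : Fin m, p (x i))
        / (1 - rejCurve (Measure.pi fun _ : Fin m => ν) (fun x : Fin m → Y => ∏ i, p (x i))
            (fun x : Fin m → Y => ∏ i, q (x i)) ((∏ i, p (x i)) / ∏ i, q (x i)))
        ∂(Measure.pi fun _ : Fin m => ν)) ^ (1 / (m : ℝ))) atTop
      (𝓝 (∫ a, p a / q a * p a ∂ν)) := by
  have hW0 : 0 < ∫ a, p a / q a * p a ∂ν :=
    integral_pos_of_pos (fun a => mul_pos (div_pos (hp0 a) (hq0 a)) (hp0 a)) hW hq1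
  refine tendsto_rpow_inv_of_mem_Icc_pow hW0 fun m => ?_
  obtain ⟨-, hPm, hPi, hP1⟩ := piDensity_facts (ι := Fin m) (μ := fun _ : Fin m => ν)
    (p := fun _ => p) (fun _ a => (hp0 a).le) (fun _ => hpm) fun _ => hpi
  obtain ⟨-, hQm, hQi, hQ1⟩ := piDensity_facts (ι := Fin m) (μ := fun _ : Fin m => ν)
    (p := fun _ => q) (fun _ a => (hq0 a).le) (fun _ => hqm) fun _ => hqi
  rw [prod_eq_one fun i _ => hq1] at hQ1
  rw [prod_eq_one fun i _ => hp1] at hP1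
  have hPpos : ∀ x : Fin m → Y, 0 < ∏ i, p (x i) := fun x => prod_pos fun i _ => hp0 (x i)
  have hQpos : ∀ x : Fin m → Y, 0 < ∏ i, q (x i) := fun x => prod_pos fun i _ => hq0 (x i)
  have hW₂ : Integrable (fun x : Fin m → Y => (∏ i, p (x i)) / (∏ i, q (x i)) * ∏ i, p (x i))
      (Measure.pi fun _ : Fin m => ν) := by
    have e : (fun x : Fin m → Y => (∏ i, p (x i)) / (∏ i, q (x i)) * ∏ i, p (x i))
        = fun x => ∏ i, (p (x i) / q (x i) * p (x i)) := by
      funext x; rw [prod_mul_distrib, prod_div_distrib]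
    rw [e]
    exact Integrable.fintype_prod (μ := fun _ : Fin m => ν) fun _ => hW
  have h := holdingTime_mem_Icc (μ := Measure.pi fun _ : Fin m => ν) hPpos hPm hPi hQpos hQm hQi hQ1 hW₂
  rw [hP1, integral_piWeightMoment_const (ι := Fin m) p q, Fintype.card_fin, div_one, mul_div_assoc,
    div_one] at h
  exact h

end General

end Summit.Ventures.LatticeQCDFlow.Theory2
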